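import Literature.IUT.HodgeTheaters.GlobalFrobenioidsCyclotomeIsoOfIntegralLaws
import HarnessLib

/-!
# [IUTchI] Example 5.1 (v), p. 128, second display — the law set of
# `UniqueCyclotomeIsoFamily.of_integral_laws` is JOINTLY SATISFIABLE (toy witness, proof-only)

S. Mochizuki, *Inter-universal Teichmüller theory I*, kurims manuscript (May 2020), §5, Example 5.1 (v)
p. 128 ([IUTchI] Ex 5.1 (v) p.128) [claim: Mochizuki2012, status: disputed].  WITNESS-class, proof-only
(no `def`, no instance): the hypotheses (E), (T), (V), (I), (P) of abc-iut-w4-d057's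
`UniqueCyclotomeIsoFamily.of_integral_laws` (E51/L28 at the printed ground "compatible with the
integral submonoids `𝒪^⊿_𝔭`") hold SIMULTANEOUSLY and NON-TRIVIALLY at the following toy comparison
family (label: TOY — a shadow of the mod layer `F_mod^× ↪ lim H¹`, NOT the arithmetic object): trivial
cyclotomes, both containers `= Ẑ` with the GENUINE twist `twist u = u ∈ Aut(Ẑ) = Ẑ^×`, one layer
`im = η(ℤ) ⊆ Ẑ` ["the Kummer classes of the constants"], one integral submonoid `int = η(ℤ_{≥0})`
["`𝒪^⊿_𝔭`"], valuation `val(η d) = d`.  So the repaired law set is not vacuous — in contrast with the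
zero/pole pair of `UniqueCyclotomeIsoFamily.of_laws`, which `CyclotomeFamily.zeroPoleLaws_false_of_inv_closed`
shows to be unsatisfiable on any inversion-closed layer.  Nothing of the series is asserted; no side is
taken on [IUTchIII] Cor. 3.12.
-/

namespace Literature.IUT.HodgeTheaters

namespace CyclotomeIsoIntegralLawsToy

open ProfiniteGrp ProfiniteGrp.ProfiniteCompletion
open Literature.AnabelianGeometry.EtaleTheta Literature.AnabelianGeometry.EtaleTheta.ZHatLevel

/-- `η : ℤ → Ẑ` is injective (two integers with the same image agree modulo every `n`).
([IUTchI] Ex 5.1 (v) p.128) [claim: Mochizuki2012, status: disputed] -/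
theorem eta_injective : Function.Injective (eta : ℤ → completion (GrpCat.of (Multiplicative ℤ))) := by
  intro a b h
  have key : ∀ n : ℕ+, ((a - b : ℤ) : ZMod n) = 0 := by
    intro n
    have h1 := congrArg (fun z => Multiplicative.toAdd (level n z)) h
    simp only [level_eta, toAdd_ofAdd] at h1
    rw [Int.cast_sub, h1, sub_self]
  have hd : ((((a - b).natAbs + 1 : ℕ) : ℤ)) ∣ a - b := by
    have := key ⟨(a - b).natAbs + 1, Nat.succ_pos _⟩
    rwa [ZMod.intCast_zmod_eq_zero_iff_dvd] at this
  have hzero : a - b = 0 :=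
    Int.eq_zero_of_dvd_of_natAbs_lt_natAbs hd (by rw [Int.natAbs_natCast]; exact Nat.lt_succ_self _)
  omega

end CyclotomeIsoIntegralLawsToy

open ProfiniteGrp ProfiniteGrp.ProfiniteCompletion
open Literature.AnabelianGeometry.EtaleTheta Literature.AnabelianGeometry.EtaleTheta.ZHatLevel
open CyclotomeIsoIntegralLawsToy in
/-- **Joint satisfiability of (E), (T), (V), (I), (P).**  At the toy family (`μ₁ = μ₂ = 1`,
`H₁ = H₂ = Ẑ`, `im = η(ℤ)`, `int = η(ℤ_{≥0})`, `induced e = id`) with `zμ u e = e`, the GENUINE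
`twist u = u` and `val (η d) = d`, every hypothesis of `UniqueCyclotomeIsoFamily.of_integral_laws`
holds (the twist is literally `fun u h => u h`), and the theorem fires. ([IUTchI] Ex 5.1 (v) p.128) [claim: Mochizuki2012, status: disputed] -/
theorem exists_family_of_integral_laws_hypotheses :
    ∃ (C : CyclotomeComparisonFamily.{0, 0, 0} Unit Unit)
      (zμ : MulAut (completion (GrpCat.of (Multiplicative ℤ))) → (C.μ₁ ≃* C.μ₂) → (C.μ₁ ≃* C.μ₂))
      (twist : MulAut (completion (GrpCat.of (Multiplicative ℤ))) → C.H₂ → C.H₂)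
      (val : Unit → C.H₂ → ℤ),
      (∀ e, zμ 1 e = e) ∧
      (∃ e, C.InducesCompatibleIsos e) ∧
      (∀ e e' : C.μ₁ ≃* C.μ₂, ∃ u : MulAut (completion (GrpCat.of (Multiplicative ℤ))),
        e' = zμ u e ∧ ∀ h, C.induced e' h = twist u (C.induced e h)) ∧
      (∀ u : MulAut (completion (GrpCat.of (Multiplicative ℤ))),
        Set.MapsTo (twist u) (C.im₂ ()) (C.im₂ ()) →
          ∀ h ∈ C.im₂ (), ∀ 𝔭 : Unit, u (eta (val 𝔭 h)) = eta (val 𝔭 (twist u h))) ∧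
      (∀ 𝔭 : Unit, ∀ h ∈ C.im₂ (), h ∈ C.int₂ 𝔭 → 0 ≤ val 𝔭 h) ∧
      (∃ 𝔭₀ : Unit, ∃ h ∈ C.im₂ (), h ∈ C.int₂ 𝔭₀ ∧ 0 < val 𝔭₀ h) ∧
      UniqueCyclotomeIsoFamily C := by
  classical
  -- the valuation: `val (η d) = d`, `0` off `η(ℤ)`
  let val : completion (GrpCat.of (Multiplicative ℤ)) → ℤ :=
    fun h => if hh : h ∈ Set.range eta then hh.choose else 0
  have hval_eta : ∀ d : ℤ, val (eta d) = d := by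
    intro d
    have hh : eta d ∈ Set.range eta := ⟨d, rfl⟩
    have h1 : val (eta d) = hh.choose := dif_pos hh
    rw [h1]
    exact eta_injective hh.choose_spec
  let C : CyclotomeComparisonFamily.{0, 0, 0} Unit Unit :=
    { μ₁ := PUnit, μ₂ := PUnit,
      H₁ := completion (GrpCat.of (Multiplicative ℤ)), H₂ := completion (GrpCat.of (Multiplicative ℤ)),
      im₁ := fun _ => Set.range eta, im₂ := fun _ => Set.range eta,
      int₁ := fun _ => eta '' {d | 0 ≤ d}, int₂ := fun _ => eta '' {d | 0 ≤ d},
      induced := fun _ h => h }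
  refine ⟨C, fun _ e => e, fun u h => u h, fun _ => val, fun _ => rfl, ?_, ?_, ?_, ?_, ?_, ?_⟩
  · -- (E): the identity satisfies the whole clause
    exact ⟨MulEquiv.refl _, fun _ => Set.bijOn_id _, fun _ => Set.bijOn_id _⟩
  · -- (T): trivial cyclotomes — `u = 1`
    intro e e'
    exact ⟨1, Subsingleton.elim _ _, fun h => (MulAut.one_apply _ h).symm⟩
  · -- (V): valuation transport for the genuine twist
    rintro u hu h ⟨d, rfl⟩ -
    obtain ⟨d', hd'⟩ := hu ⟨d, rfl⟩
    have hd'' : eta d' = u (eta d) := hd'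
    change u (eta (val (eta d))) = eta (val (u (eta d)))
    rw [hval_eta, ← hd'', hval_eta]
  · -- (I): integral classes have nonnegative valuation
    rintro - h - ⟨d, hd, rfl⟩
    change 0 ≤ val (eta d)
    rw [hval_eta]; exact hd
  · -- (P): `η 1` is integral with valuation `1`
    refine ⟨(), eta 1, ⟨1, rfl⟩, ⟨1, by norm_num, rfl⟩, ?_⟩
    change 0 < val (eta 1)
    rw [hval_eta]; exact one_pos
  · -- the theorem fires
    refine UniqueCyclotomeIsoFamily.of_integral_laws C () (fun _ e => e) (fun _ => rfl) (fun u h => u h)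
      ⟨MulEquiv.refl _, fun _ => Set.bijOn_id _, fun _ => Set.bijOn_id _⟩
      (fun e e' => ⟨1, Subsingleton.elim _ _, fun h => (MulAut.one_apply _ h).symm⟩) (fun _ => val)
      ?_ ?_ ⟨(), eta 1, ⟨1, rfl⟩, ⟨1, by norm_num, rfl⟩, by rw [hval_eta]; exact one_pos⟩
    · rintro u hu h ⟨d, rfl⟩ -
      obtain ⟨d', hd'⟩ := hu ⟨d, rfl⟩
      have hd'' : eta d' = u (eta d) := hd'
      change u (eta (val (eta d))) = eta (val (u (eta d)))
      rw [hval_eta, ← hd'', hval_eta]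
    · rintro - h - ⟨d, hd, rfl⟩
      rw [hval_eta]; exact hd

end Literature.IUT.HodgeTheaters
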